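import Summits.QuantumFields.YangMills.Theorems.BalabanUVNodesN21AtSpineCarriersMixtureTwoThresholdsCommonBox
import Summits.QuantumFields.YangMills.Theorems.BalabanUVNodesN21AtSpineCarriersMixtureCommonBoxSanity

/-!
# YM-DAG node N21 (= NE7c) — THE THRESHOLD MIXTURE, PART 5c: vacuity guard for the TWO-THRESHOLD common-box reading — the decomposition of
# unity with run B at GENUINELY DIFFERENT thresholds inhabits `s_N21_of_twoThresholdSharpCommonBoxReading`'s package, and `S_N21` FIRES on it

Track A of `YM-PLAN.md` (cell `pub-ymgap`, HUMAN RULING D-0062), node **N21**; R141 (C) fan-out seat `pub-ymgap-dag-n21-e` (s3 = ALTERNATIVE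
CURRENCY), generation 3, file 11c (guard of file 11b `…N21AtSpineCarriersMixtureTwoThresholdsCommonBox`).  Kernel bookkeeping on a TOY: 0 `def`,
0 `sorry`, standard axioms.  COUNT-NEUTRAL; `--supports` the K3′ item `SpineGivenEndpointR12` as a helper.

THE TOY (A2 junk-pin guard).  File 10c's two-term DECOMPOSITION OF UNITY (terms `true ↦ χ`, `false ↦ 1 − χ` of ONE shared occurrence per step, `e = id`,
point space, remainder `1`, width `κ = 1∕2`) with run A at threshold `θ^A ≡ 1` testing `3∕4` and run B at the GENUINELY DIFFERENT threshold
`θ^B_K = 1 + (1∕2)^K∕8` testing `θ^B_K·(3∕4 + (1∕2)^K∕8)` (file 8's numbers): gap `r = (1∕2)^j∕8` (pv07's `Sanity.ρ`), `SupClose` width `(1∕2)^j∕4`;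
carriers `A ≡ 1∕2`, `B = 1∕2 ∓ (1∕2)^K∕4` ARE the normalised averages over EACH RUN'S OWN box (`toy_average`, `toy_average_thr`); the sharp class
total of either run is `1` at EVERY threshold vector (`toy_sum_sharp`), each factor-removal sibling weight is `≤ 1` (`toy_removal_le_one`), so the
sharp class-relative bounds hold with `Ssup ≡ 2` for run A at `S` and for run B at `θ^B·S`; the clamped shell parts are `(1∕2)^K∕4 > 0` in
complementary terms (`toy_shell_true_A₂`, `toy_shell_false_B₂`); record weight `(3∕2)(1∕2)^K` (`toy_bandWeight₃`).  A toy, NOT Bałaban's terms.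

HONEST FRAMING.  Nothing of Bałaban's is asserted; NE7c NOT PRINTED ∕ NOT proved; N21 NOT discharged; count-neutral; one finite four-torus
programme at fixed `ε`; NOT continuum ∕ ℝ⁴ ∕ OS ∕ mass gap ∕ Clay.

CITATION HEADER (lean-in-tree rule 2026-08-18).  BY NAME: file 11b `s_N21_of_twoThresholdSharpCommonBoxReading`; file 10c `toy_average`,
`toy_sum_sharp`; file 5a `sharpMixture_prod_eq_profile_prod`; file 9 `prod_ite_fac_smallInd_mem_unitInterval`; `T4LipschitzCutoff.linProfile` ∕
`lipWeight` ∕ `minPiece`; `T4LipschitzLedger.SupClose` ∕ `shellW` ∕ `pieceAt` ∕ `facAt` ∕ `Pol` and pv07's toy letters `T4LipschitzLedger.Sanity.ρ ∕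
summable_ρ ∕ half_pow_pos ∕ half_pow_le_one ∕ profile_A ∕ profile_B`; `T4IndicatorShell.smallInd`; `…ClustersCore` (`SpineCarriers`, `SpineRecordPred`,
`S_N21`); `…N21AtSpineCarriers.exists_family_and_datum`.

WHAT IS PROVED ([folklore]).  `toy_average_thr`, `toy_removal_le_one`, `toy_clampA`, `toy_clampB`, `toy_clampA_fun`, `toy_clampB_fun`, `toy_shell_true_A₂`, `toy_shell_false_B₂`,
`toy_bandWeight₃`, `toy_supClose₂`, **`s_N21_fires_on_twoThresholdSharpCommonBoxReading`**.
-/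

set_option autoImplicit false

noncomputable section

open MeasureTheory Set
open scoped BigOperators ENNReal

namespace Summit.QuantumFields.YangMills.Theorems.N21AtSpineCarriersMixtureTwoThresholdsCommonBoxSanity

open YMDAG.UVSplit (SpineCarriers SpineRecordPred S_N21)
open Literature.MathematicalPhysics.QuantumFieldTheory.Balaban1983to89
open Literature.MathematicalPhysics.QuantumFieldTheory.Balaban1983to89.T4LipschitzCutoff
open Literature.MathematicalPhysics.QuantumFieldTheory.Balaban1983to89.T4IndicatorShell
open Literature.MathematicalPhysics.QuantumFieldTheory.Balaban1983to89.T4LipschitzLedger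
open T4LipschitzLedger.Sanity (half_pow_pos half_pow_le_one profile_A profile_B summable_ρ)
open N21ThresholdMixture (sharpMixture_prod_eq_profile_prod)
open N21ThresholdMixtureSibling (prod_ite_fac_smallInd_mem_unitInterval)
open N21AtSpineCarriersMixtureCommonBoxSanity (toy_average toy_sum_sharp)
open N21AtSpineCarriersMixtureTwoThresholdsCommonBox (s_N21_of_twoThresholdSharpCommonBoxReading)

/-! ## Toy letters -/

/-- THE ONE-OCCURRENCE MIXTURE IDENTITY AT ANY POSITIVE THRESHOLD, either polarity: the normalised average over `s ∈ [θ∕2, θ]` of `p.fac (1[u < s])`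
is `p.fac (linProfile (1∕2) (u∕θ))`. [folklore] -/
theorem toy_average_thr (p : Pol) {θ : ℝ} (hθ : 0 < θ) (u : ℝ) :
    (∏ _i : Fin 1, ((1 / 2 : ℝ) * θ))⁻¹ *
        ∫ s : Fin 1 → ℝ, (∫ _v : Unit, (∏ i : Fin 1, p.fac (smallInd u (s i))) * (1 : ℝ) ∂(Measure.dirac ()))
          ∂(Measure.pi fun _ : Fin 1 => volume.restrict (Icc ((1 - (1 / 2 : ℝ)) * θ) θ)) =
      p.fac (linProfile (1 / 2) (u / θ)) := by
  have h := sharpMixture_prod_eq_profile_prod (m := 1) (fun _ => p) (fun _ => (1 / 2 : ℝ)) (fun _ => θ) (fun _ => u)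
    (fun _ => by norm_num) (fun _ => hθ)
  simp only [integral_dirac, mul_one, Fin.prod_univ_one] at h ⊢
  rw [h, ← mul_assoc, inv_mul_cancel₀ (by positivity : (1 / 2 : ℝ) * θ ≠ 0), one_mul]

/-- EACH FACTOR-REMOVAL SIBLING WEIGHT of the toy (removed factor's shell at an arbitrary argument `w` and width `Δ`, empty product of other
factors, remainder `1`, point space) IS AT MOST `1`. [folklore] -/
theorem toy_removal_le_one (p : Pol) (w u Δ : ℝ) (σ : Σ _ : ℕ, ℕ) (s : Fin 1 → ℝ) :
    ∑ i ∈ (Finset.range 1).filter (fun _ => (⟨0, 0⟩ : Σ _ : ℕ, ℕ) = σ),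
        ∫ _v : Unit, p.shell w 1 (1 / 2) Δ * (∏ j : Fin 1, (if (j : ℕ) = i then (1 : ℝ) else p.fac (smallInd u (s j)))) * (1 : ℝ)
          ∂(Measure.dirac ()) ≤ 1 := by
  have h01 : ∀ i : ℕ, 0 ≤ ∏ j : Fin 1, (if (j : ℕ) = i then (1 : ℝ) else p.fac (smallInd u (s j))) ∧
      ∏ j : Fin 1, (if (j : ℕ) = i then (1 : ℝ) else p.fac (smallInd u (s j))) ≤ 1 := fun i =>
    prod_ite_fac_smallInd_mem_unitInterval (fun _ : Fin 1 => p) (fun _ => u) s i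
  calc ∑ i ∈ (Finset.range 1).filter (fun _ => (⟨0, 0⟩ : Σ _ : ℕ, ℕ) = σ),
        ∫ _v : Unit, p.shell w 1 (1 / 2) Δ * (∏ j : Fin 1, (if (j : ℕ) = i then (1 : ℝ) else p.fac (smallInd u (s j)))) * (1 : ℝ)
          ∂(Measure.dirac ())
      ≤ ∑ i ∈ Finset.range 1,
        ∫ _v : Unit, p.shell w 1 (1 / 2) Δ * (∏ j : Fin 1, (if (j : ℕ) = i then (1 : ℝ) else p.fac (smallInd u (s j)))) * (1 : ℝ)
          ∂(Measure.dirac ()) := by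
        refine Finset.sum_le_sum_of_subset_of_nonneg (Finset.filter_subset _ _) fun i _ _ => ?_
        simp only [integral_dirac, mul_one]
        exact mul_nonneg (Pol.shell_nonneg _ _ _ _ _) (h01 i).1
    _ ≤ 1 := by
        simp only [integral_dirac, mul_one, Finset.sum_range_one]
        exact mul_le_one₀ (Pol.shell_le_one _ _ _ _ _) (h01 0).1 (h01 0).2

/-- the clamp of run A's tested value `3∕4` at threshold `1`, width `1∕2`, is `3∕4`. [folklore] -/
theorem toy_clampA : max ((1 - (1 / 2 : ℝ)) * 1) (min 1 (3 / 4 : ℝ)) = 3 / 4 := by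
  rw [min_eq_right (by norm_num), max_eq_right (by norm_num)]

/-- the rescaled clamp of run B's tested value `θ^B_K(3∕4 + (1∕2)^K∕8)` in run A's units is `3∕4 + (1∕2)^K∕8`. [folklore] -/
theorem toy_clampB (K : ℕ) :
    max ((1 - (1 / 2 : ℝ)) * 1) (min 1 (1 / (1 + (1 / 2 : ℝ) ^ K / 8) * ((1 + (1 / 2 : ℝ) ^ K / 8) * (3 / 4 + (1 / 2 : ℝ) ^ K / 8)))) =
      3 / 4 + (1 / 2 : ℝ) ^ K / 8 := by
  have hx0 := half_pow_pos K
  have hx1 := half_pow_le_one K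
  have hθ : (1 + (1 / 2 : ℝ) ^ K / 8) ≠ 0 := by positivity
  rw [← mul_assoc, one_div_mul_cancel hθ, one_mul, min_eq_right (by linarith), max_eq_right (by linarith)]

/-- function form of `toy_clampA` in the package's letters (the clamped run-A variable IS file 10c's run-A variable). [folklore] -/
theorem toy_clampA_fun :
    (fun (K : ℕ) (τ : Bool) (i : ℕ) (v : Unit) => max ((1 - (fun _ : ℕ => (1 / 2 : ℝ)) ((fun (_ : ℕ) (_ : Bool) (_ : ℕ) =>
        (⟨0, 0⟩ : Σ _ : ℕ, ℕ)) K τ i).1) * (fun (_ : ℕ) (_ : Bool) (_ : ℕ) => (1 : ℝ)) K τ i)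
        (min ((fun (_ : ℕ) (_ : Bool) (_ : ℕ) => (1 : ℝ)) K τ i) ((fun (_ : ℕ) (_ : Bool) (_ : ℕ) (_ : Unit) => (3 / 4 : ℝ)) K τ i v))) =
      fun (_ : ℕ) (_ : Bool) (_ : ℕ) (_ : Unit) => (3 / 4 : ℝ) := by
  funext K τ i v
  exact toy_clampA

/-- function form of `toy_clampB` (the clamped-rescaled run-B variable IS file 10c's run-B variable). [folklore] -/
theorem toy_clampB_fun :
    (fun (K : ℕ) (τ : Bool) (i : ℕ) (v : Unit) => max ((1 - (fun _ : ℕ => (1 / 2 : ℝ)) ((fun (_ : ℕ) (_ : Bool) (_ : ℕ) =>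
        (⟨0, 0⟩ : Σ _ : ℕ, ℕ)) K τ i).1) * (fun (_ : ℕ) (_ : Bool) (_ : ℕ) => (1 : ℝ)) K τ i)
        (min ((fun (_ : ℕ) (_ : Bool) (_ : ℕ) => (1 : ℝ)) K τ i)
          ((fun (_ : ℕ) (_ : Bool) (_ : ℕ) => (1 : ℝ)) K τ i / (fun (K : ℕ) (_ : Bool) (_ : ℕ) => 1 + (1 / 2 : ℝ) ^ K / 8) K τ i *
            (fun (K : ℕ) (_ : Bool) (_ : ℕ) (_ : Unit) => (1 + (1 / 2 : ℝ) ^ K / 8) * (3 / 4 + (1 / 2 : ℝ) ^ K / 8)) K τ i v))) =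
      fun (K : ℕ) (_ : Bool) (_ : ℕ) (_ : Unit) => 3 / 4 + (1 / 2 : ℝ) ^ K / 8 := by
  funext K τ i v
  exact toy_clampB K

/-- RUN A's CLAMPED SHELL PART IN THE `χ`-TERM is `(1∕2)^K∕4`. [folklore] -/
theorem toy_shell_true_A₂ (K : ℕ) (t : ℝ) :
    shellW (fun a => linProfile ((fun _ : ℕ => (1 / 2 : ℝ)) a)) (fun _ _ => Measure.dirac ()) (fun _ _ => 1) (fun _ _ _ => ⟨0, 0⟩)
        (fun (_ : ℕ) (b : Bool) (_ : ℕ) => cond b Pol.small Pol.large) (fun _ _ _ => (1 : ℝ))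
        (fun K τ i (v : Unit) => max ((1 - (fun _ : ℕ => (1 / 2 : ℝ)) ((fun (_ : ℕ) (_ : Bool) (_ : ℕ) => (⟨0, 0⟩ : Σ _ : ℕ, ℕ)) K τ i).1) *
          (fun (_ : ℕ) (_ : Bool) (_ : ℕ) => (1 : ℝ)) K τ i) (min ((fun (_ : ℕ) (_ : Bool) (_ : ℕ) => (1 : ℝ)) K τ i)
            ((fun (_ : ℕ) (_ : Bool) (_ : ℕ) (_ : Unit) => (3 / 4 : ℝ)) K τ i v)))
        (fun K τ i (v : Unit) => max ((1 - (fun _ : ℕ => (1 / 2 : ℝ)) ((fun (_ : ℕ) (_ : Bool) (_ : ℕ) => (⟨0, 0⟩ : Σ _ : ℕ, ℕ)) K τ i).1) *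
          (fun (_ : ℕ) (_ : Bool) (_ : ℕ) => (1 : ℝ)) K τ i) (min ((fun (_ : ℕ) (_ : Bool) (_ : ℕ) => (1 : ℝ)) K τ i)
            ((fun (_ : ℕ) (_ : Bool) (_ : ℕ) => (1 : ℝ)) K τ i / (fun (K : ℕ) (_ : Bool) (_ : ℕ) => 1 + (1 / 2 : ℝ) ^ K / 8) K τ i *
              (fun (K : ℕ) (_ : Bool) (_ : ℕ) (_ : Unit) => (1 + (1 / 2 : ℝ) ^ K / 8) * (3 / 4 + (1 / 2 : ℝ) ^ K / 8)) K τ i v)))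
        (fun _ _ _ (_ : Unit) => (1 : ℝ)) K t true = (1 / 2 : ℝ) ^ K / 4 := by
  rw [toy_clampA_fun, toy_clampB_fun]
  exact N21AtSpineCarriersMixtureCommonBoxSanity.toy_shell_true_A K t

/-- RUN B's CLAMPED SHELL PART IN THE `1 − χ`-TERM is `(1∕2)^K∕4`. [folklore] -/
theorem toy_shell_false_B₂ (K : ℕ) (t : ℝ) :
    shellW (fun a => linProfile ((fun _ : ℕ => (1 / 2 : ℝ)) a)) (fun _ _ => Measure.dirac ()) (fun _ _ => 1) (fun _ _ _ => ⟨0, 0⟩)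
        (fun (_ : ℕ) (b : Bool) (_ : ℕ) => cond b Pol.small Pol.large) (fun _ _ _ => (1 : ℝ))
        (fun K τ i (v : Unit) => max ((1 - (fun _ : ℕ => (1 / 2 : ℝ)) ((fun (_ : ℕ) (_ : Bool) (_ : ℕ) => (⟨0, 0⟩ : Σ _ : ℕ, ℕ)) K τ i).1) *
          (fun (_ : ℕ) (_ : Bool) (_ : ℕ) => (1 : ℝ)) K τ i) (min ((fun (_ : ℕ) (_ : Bool) (_ : ℕ) => (1 : ℝ)) K τ i)
            ((fun (_ : ℕ) (_ : Bool) (_ : ℕ) => (1 : ℝ)) K τ i / (fun (K : ℕ) (_ : Bool) (_ : ℕ) => 1 + (1 / 2 : ℝ) ^ K / 8) K τ i *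
              (fun (K : ℕ) (_ : Bool) (_ : ℕ) (_ : Unit) => (1 + (1 / 2 : ℝ) ^ K / 8) * (3 / 4 + (1 / 2 : ℝ) ^ K / 8)) K τ i v)))
        (fun K τ i (v : Unit) => max ((1 - (fun _ : ℕ => (1 / 2 : ℝ)) ((fun (_ : ℕ) (_ : Bool) (_ : ℕ) => (⟨0, 0⟩ : Σ _ : ℕ, ℕ)) K τ i).1) *
          (fun (_ : ℕ) (_ : Bool) (_ : ℕ) => (1 : ℝ)) K τ i) (min ((fun (_ : ℕ) (_ : Bool) (_ : ℕ) => (1 : ℝ)) K τ i)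
            ((fun (_ : ℕ) (_ : Bool) (_ : ℕ) (_ : Unit) => (3 / 4 : ℝ)) K τ i v)))
        (fun _ _ _ (_ : Unit) => (1 : ℝ)) K t false = (1 / 2 : ℝ) ^ K / 4 := by
  rw [toy_clampA_fun, toy_clampB_fun]
  exact N21AtSpineCarriersMixtureCommonBoxSanity.toy_shell_false_B K t

/-- THE BAND WEIGHT of the toy at width `ρ + r = (1∕2)^j∕4 + (1∕2)^j∕8` with `Ssup ≡ 2`: `(3∕2)(1∕2)^K`. [folklore] -/
theorem toy_bandWeight₃ (K : ℕ) :
    ∑ a ∈ Finset.range (0 + 1), ((fun _ : ℕ => (1 : ℕ)) a : ℝ) * lipWeight (fun a => ((fun _ : ℕ => (1 / 2 : ℝ)) a)⁻¹) (fun _ => 2)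
      (fun j => (fun j : ℕ => (1 / 2 : ℝ) ^ j / 4) j + T4LipschitzLedger.Sanity.ρ j) a K = 3 / 2 * (1 / 2 : ℝ) ^ K := by
  simp only [zero_add, Finset.sum_range_one, Nat.cast_one, one_mul, lipWeight, Nat.zero_le, if_true, T4LipschitzLedger.Sanity.ρ,
    Nat.sub_zero]
  ring

/-- `SupClose` AT RUN A's THRESHOLD for the toy: `|3∕4 − θ^B_K(3∕4 + (1∕2)^K∕8)| ≤ (1∕2)^K∕4`. [folklore] -/
theorem toy_supClose₂ (K : ℕ) :
    |(3 / 4 : ℝ) - (1 + (1 / 2 : ℝ) ^ K / 8) * (3 / 4 + (1 / 2 : ℝ) ^ K / 8)| ≤ (1 / 2 : ℝ) ^ K / 4 * 1 := by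
  have hx0 := half_pow_pos K
  have hx1 := half_pow_le_one K
  rw [abs_sub_comm, abs_of_nonneg (by nlinarith)]
  nlinarith

/-! ## The two-threshold common-box reading is inhabited and `S_N21` FIRES on it -/

/-- **THE TWO-THRESHOLD COMMON-BOX SHARP-MIXTURE READING IS INHABITED (GENUINELY DIFFERENT THRESHOLDS) AND `S_N21` FIRES ON IT.**  There is a
carrier predicate `SRec` over `SU(2)` data such that (i) `SRec` is a two-threshold common-box reading predicate — every bundle it pins carries EXACTLY
the package of file 11b §2; (ii) it is INHABITED by the decomposition of unity above with `θ^A ≡ 1 ≠ θ^B_K = 1 + (1∕2)^K∕8`: both runs' carriers are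
the normalised averages over THEIR OWN boxes, `SupClose` at `θ^A` with width `(1∕2)^j∕4`, gap `(1∕2)^j∕8`, the SHARP class-relative factor-removal
bounds hold with `Ssup ≡ 2` for run A at `S` and for run B at `θ^B·S` (class totals `1` at every threshold), nonempty classes, positive carriers,
each run's clamped shell part positive in one term, positive record weight; (iii) the two threshold families DIFFER at every step; (iv)
`S_N21 SRec` (file 11b §2).  A toy, NOT Bałaban's terms. [folklore] -/
theorem s_N21_fires_on_twoThresholdSharpCommonBoxReading :
    ∃ SRec : SpineRecordPred 2,
      (∃ (F : T4Continuum.T4Family) (D : YMDAG.UVSplit.Datum F 2) (g₀ : ℕ → ℝ) (os : List (T4Continuum.ULoop F))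
          (S : SpineCarriers), SRec F D g₀ os S ∧ (∀ K, (S.T K).Nonempty) ∧ (∀ K t τ, 0 < S.A K t τ ∧ 0 < S.B K t τ) ∧
          (∀ K t, (∃ τ, 0 < S.shA K t τ) ∧ (∃ τ, 0 < S.shB K t τ)) ∧ ∀ K, 0 < S.Wsh K) ∧
      (∀ K : ℕ, (1 : ℝ) ≠ 1 + (1 / 2 : ℝ) ^ K / 8) ∧
      S_N21 SRec := by
  obtain ⟨F, ⟨Dat⟩⟩ := N21AtSpineCarriers.exists_family_and_datum
  have hsumW : Summable fun K : ℕ => 3 / 2 * (1 / 2 : ℝ) ^ K :=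
    (summable_geometric_of_lt_one (by norm_num) (by norm_num : (1 / 2 : ℝ) < 1)).mul_left (3 / 2)
  have hρsum : Summable fun j : ℕ => (1 / 2 : ℝ) ^ j / 4 :=
    (summable_geometric_of_lt_one (by norm_num) (by norm_num : (1 / 2 : ℝ) < 1)).div_const 4
  have hθB : ∀ K : ℕ, (0 : ℝ) < 1 + (1 / 2 : ℝ) ^ K / 8 := fun K => by positivity
  refine ⟨_, ?_, fun K => ?_, s_N21_of_twoThresholdSharpCommonBoxReading (N := 2) _ fun _ _ _ _ _ h => h⟩
  swap
  · exact ne_of_lt (by have := half_pow_pos K; linarith)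
  refine ⟨F, Dat, fun _ => 0, [],
    { ι := Bool, l₀ := 1, vol := 1, K₀ := 0, T := fun _ => Finset.univ, A := fun _ _ _ => 1 / 2,
      B := fun K _ b => cond b (1 / 2 - (1 / 2 : ℝ) ^ K / 4) (1 / 2 + (1 / 2 : ℝ) ^ K / 4),
      shA := shellW (fun a => linProfile ((fun _ : ℕ => (1 / 2 : ℝ)) a)) (fun _ _ => Measure.dirac ()) (fun _ _ => 1) (fun _ _ _ => ⟨0, 0⟩)
        (fun (_ : ℕ) (b : Bool) (_ : ℕ) => cond b Pol.small Pol.large) (fun _ _ _ => (1 : ℝ))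
        (fun K τ i (v : Unit) => max ((1 - (fun _ : ℕ => (1 / 2 : ℝ)) ((fun (_ : ℕ) (_ : Bool) (_ : ℕ) => (⟨0, 0⟩ : Σ _ : ℕ, ℕ)) K τ i).1) *
          (fun (_ : ℕ) (_ : Bool) (_ : ℕ) => (1 : ℝ)) K τ i) (min ((fun (_ : ℕ) (_ : Bool) (_ : ℕ) => (1 : ℝ)) K τ i)
            ((fun (_ : ℕ) (_ : Bool) (_ : ℕ) (_ : Unit) => (3 / 4 : ℝ)) K τ i v)))
        (fun K τ i (v : Unit) => max ((1 - (fun _ : ℕ => (1 / 2 : ℝ)) ((fun (_ : ℕ) (_ : Bool) (_ : ℕ) => (⟨0, 0⟩ : Σ _ : ℕ, ℕ)) K τ i).1) *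
          (fun (_ : ℕ) (_ : Bool) (_ : ℕ) => (1 : ℝ)) K τ i) (min ((fun (_ : ℕ) (_ : Bool) (_ : ℕ) => (1 : ℝ)) K τ i)
            ((fun (_ : ℕ) (_ : Bool) (_ : ℕ) => (1 : ℝ)) K τ i / (fun (K : ℕ) (_ : Bool) (_ : ℕ) => 1 + (1 / 2 : ℝ) ^ K / 8) K τ i *
              (fun (K : ℕ) (_ : Bool) (_ : ℕ) (_ : Unit) => (1 + (1 / 2 : ℝ) ^ K / 8) * (3 / 4 + (1 / 2 : ℝ) ^ K / 8)) K τ i v)))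
        (fun _ _ _ (_ : Unit) => (1 : ℝ)),
      shB := shellW (fun a => linProfile ((fun _ : ℕ => (1 / 2 : ℝ)) a)) (fun _ _ => Measure.dirac ()) (fun _ _ => 1) (fun _ _ _ => ⟨0, 0⟩)
        (fun (_ : ℕ) (b : Bool) (_ : ℕ) => cond b Pol.small Pol.large) (fun _ _ _ => (1 : ℝ))
        (fun K τ i (v : Unit) => max ((1 - (fun _ : ℕ => (1 / 2 : ℝ)) ((fun (_ : ℕ) (_ : Bool) (_ : ℕ) => (⟨0, 0⟩ : Σ _ : ℕ, ℕ)) K τ i).1) *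
          (fun (_ : ℕ) (_ : Bool) (_ : ℕ) => (1 : ℝ)) K τ i) (min ((fun (_ : ℕ) (_ : Bool) (_ : ℕ) => (1 : ℝ)) K τ i)
            ((fun (_ : ℕ) (_ : Bool) (_ : ℕ) => (1 : ℝ)) K τ i / (fun (K : ℕ) (_ : Bool) (_ : ℕ) => 1 + (1 / 2 : ℝ) ^ K / 8) K τ i *
              (fun (K : ℕ) (_ : Bool) (_ : ℕ) (_ : Unit) => (1 + (1 / 2 : ℝ) ^ K / 8) * (3 / 4 + (1 / 2 : ℝ) ^ K / 8)) K τ i v)))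
        (fun K τ i (v : Unit) => max ((1 - (fun _ : ℕ => (1 / 2 : ℝ)) ((fun (_ : ℕ) (_ : Bool) (_ : ℕ) => (⟨0, 0⟩ : Σ _ : ℕ, ℕ)) K τ i).1) *
          (fun (_ : ℕ) (_ : Bool) (_ : ℕ) => (1 : ℝ)) K τ i) (min ((fun (_ : ℕ) (_ : Bool) (_ : ℕ) => (1 : ℝ)) K τ i)
            ((fun (_ : ℕ) (_ : Bool) (_ : ℕ) (_ : Unit) => (3 / 4 : ℝ)) K τ i v)))
        (fun _ _ _ (_ : Unit) => (1 : ℝ)),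
      Bad := fun _ _ => ∅, W := fun _ => 0, Wsh := fun K => 3 / 2 * (1 / 2 : ℝ) ^ K, δ := fun _ => 0 }, ?_, ?_, ?_, ?_, ?_⟩
  · -- the package of file 11b §2 at the toy data
    refine ⟨fun _ _ => Unit, inferInstance, fun _ _ => Measure.dirac (), fun _ _ => inferInstance, fun _ => 1 / 2, 0, fun _ => 1,
      fun _ _ => 1, fun _ _ _ => ⟨0, 0⟩, fun _ b _ => cond b Pol.small Pol.large, fun _ _ _ => 1, fun K _ _ => 1 + (1 / 2 : ℝ) ^ K / 8,
      fun _ _ _ _ => 3 / 4, fun K _ _ _ => (1 + (1 / 2 : ℝ) ^ K / 8) * (3 / 4 + (1 / 2 : ℝ) ^ K / 8), fun _ _ _ _ => 1, fun _ _ _ _ => 1,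
      fun K t b s => ∫ v, (∏ i : Fin 1, (cond b Pol.small Pol.large).fac (smallInd ((fun (_ : Unit) => (3 / 4 : ℝ)) v) (s i))) *
        (fun (_ : Unit) => (1 : ℝ)) v ∂(Measure.dirac ()),
      fun K t b s => ∫ v, (∏ i : Fin 1, (cond b Pol.small Pol.large).fac
        (smallInd ((fun (_ : Unit) => (1 + (1 / 2 : ℝ) ^ K / 8) * (3 / 4 + (1 / 2 : ℝ) ^ K / 8)) v) (s i))) *
          (fun (_ : Unit) => (1 : ℝ)) v ∂(Measure.dirac ()),
      fun j => (1 / 2 : ℝ) ^ j / 4, T4LipschitzLedger.Sanity.ρ, fun _ => 2, fun _ => 1, fun _ _ => 0, fun _ _ => 1, fun _ _ j => j,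
      fun σ K t b s => ∑ i ∈ (Finset.range 1).filter (fun _ => (⟨0, 0⟩ : Σ _ : ℕ, ℕ) = σ),
        ∫ v, (cond b Pol.small Pol.large).shell (max ((1 - (1 / 2 : ℝ)) * 1) (min 1 ((fun (_ : Unit) => (3 / 4 : ℝ)) v))) 1 (1 / 2)
            (((1 / 2 : ℝ) ^ (K - 0) / 4 + T4LipschitzLedger.Sanity.ρ (K - 0)) * 1) *
          (∏ j : Fin 1, (if (j : ℕ) = i then (1 : ℝ) else (cond b Pol.small Pol.large).fac
            (smallInd ((fun (_ : Unit) => (3 / 4 : ℝ)) v) (s j)))) * (fun (_ : Unit) => (1 : ℝ)) v ∂(Measure.dirac ()),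
      fun σ K t b s => ∑ i ∈ (Finset.range 1).filter (fun _ => (⟨0, 0⟩ : Σ _ : ℕ, ℕ) = σ),
        ∫ v, (cond b Pol.small Pol.large).shell (max ((1 - (1 / 2 : ℝ)) * 1) (min 1 (1 / (1 + (1 / 2 : ℝ) ^ K / 8) *
            ((fun (_ : Unit) => (1 + (1 / 2 : ℝ) ^ K / 8) * (3 / 4 + (1 / 2 : ℝ) ^ K / 8)) v)))) 1 (1 / 2)
            (((1 / 2 : ℝ) ^ (K - 0) / 4 + T4LipschitzLedger.Sanity.ρ (K - 0)) * 1) *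
          (∏ j : Fin 1, (if (j : ℕ) = i then (1 : ℝ) else (cond b Pol.small Pol.large).fac
            (smallInd ((fun (_ : Unit) => (1 + (1 / 2 : ℝ) ^ K / 8) * (3 / 4 + (1 / 2 : ℝ) ^ K / 8)) v) (s j)))) *
            (fun (_ : Unit) => (1 : ℝ)) v ∂(Measure.dirac ()),
      fun _ => by norm_num, fun _ _ _ _ _ => by norm_num, fun K _ _ _ _ => hθB K, fun _ _ _ _ _ => by simp [Finset.mem_sigma],
      fun _ _ _ _ _ => Nat.zero_le _, fun _ _ _ _ _ => ⟨measurable_const, measurable_const⟩, fun _ _ _ _ _ => ae_of_all _ fun _ => zero_le_one,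
      fun _ _ _ _ _ => integrable_const _, fun _ _ _ _ _ => ae_of_all _ fun _ => zero_le_one, fun _ _ _ _ _ => integrable_const _,
      fun _ _ _ _ _ _ => rfl, fun _ _ _ _ _ _ => rfl, ?_, ?_, ?_, ?_, fun _ _ _ _ _ _ _ => rfl, fun _ _ _ _ _ _ _ => rfl,
      fun _ _ => one_pos, fun _ _ _ => fun a b h => h, fun _ _ _ _ => rfl, fun _ _ _ _ => rfl, ?_, ?_, fun _ _ => by norm_num,
      fun j => by positivity, fun j => by unfold T4LipschitzLedger.Sanity.ρ; positivity, hρsum, summable_ρ, rfl, rfl,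
      fun K => (toy_bandWeight₃ K).le, hsumW⟩
    · -- run A's carriers: normalised averages over run A's box
      intro K t _ b _
      show (1 / 2 : ℝ) = (∏ _i : Fin 1, ((1 / 2 : ℝ) * 1))⁻¹ *
        ∫ s : Fin 1 → ℝ, (∫ _v : Unit, (∏ i : Fin 1, (cond b Pol.small Pol.large).fac (smallInd (3 / 4 : ℝ) (s i))) * (1 : ℝ)
          ∂(Measure.dirac ())) ∂(Measure.pi fun _ : Fin 1 => volume.restrict (Icc ((1 - (1 / 2 : ℝ)) * 1) 1))
      rw [toy_average, profile_A]
      cases b <;> simp only [Bool.cond_true, Bool.cond_false, Pol.fac_small, Pol.fac_large]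
      norm_num
    · -- run B's carriers: normalised averages over run B's OWN box at `θ^B_K`
      intro K t _ b _
      show cond b (1 / 2 - (1 / 2 : ℝ) ^ K / 4) (1 / 2 + (1 / 2 : ℝ) ^ K / 4) = (∏ _i : Fin 1, ((1 / 2 : ℝ) * (1 + (1 / 2 : ℝ) ^ K / 8)))⁻¹ *
        ∫ s : Fin 1 → ℝ, (∫ _v : Unit, (∏ i : Fin 1, (cond b Pol.small Pol.large).fac
          (smallInd ((1 + (1 / 2 : ℝ) ^ K / 8) * (3 / 4 + (1 / 2 : ℝ) ^ K / 8)) (s i))) * (1 : ℝ) ∂(Measure.dirac ()))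
          ∂(Measure.pi fun _ : Fin 1 => volume.restrict (Icc ((1 - (1 / 2 : ℝ)) * (1 + (1 / 2 : ℝ) ^ K / 8)) (1 + (1 / 2 : ℝ) ^ K / 8)))
      rw [toy_average_thr _ (hθB K), mul_div_cancel_left₀ _ (hθB K).ne']
      have h := profile_B K
      rw [div_one] at h
      rw [h]
      cases b <;> simp only [Bool.cond_true, Bool.cond_false, Pol.fac_small, Pol.fac_large]
      ring
    · -- `SupClose` at `θ^A`, width `(1∕2)^j∕4`
      intro K b _ i _
      refine ae_of_all _ fun v => ?_
      show |(3 / 4 : ℝ) - (1 + (1 / 2 : ℝ) ^ K / 8) * (3 / 4 + (1 / 2 : ℝ) ^ K / 8)| ≤ (1 / 2 : ℝ) ^ (K - 0) / 4 * 1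
      rw [Nat.sub_zero]
      exact toy_supClose₂ K
    · -- the threshold gap `|θ^A − θ^B| ≤ r·θ^A`
      intro K b _ i _
      show |(1 : ℝ) - (1 + (1 / 2 : ℝ) ^ K / 8)| ≤ T4LipschitzLedger.Sanity.ρ (K - 0) * 1
      rw [T4LipschitzLedger.Sanity.ρ, Nat.sub_zero, mul_one, show (1 : ℝ) - (1 + (1 / 2 : ℝ) ^ K / 8) = -((1 / 2 : ℝ) ^ K / 8) by ring,
        abs_neg, abs_of_nonneg (by positivity)]
    · -- run A: the SHARP class-relative factor-removal bound at EVERY multiplier assignment, `Ssup ≡ 2`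
      intro σ _ K t _ Sv _
      show ∑ b : Bool, ∑ i ∈ (Finset.range 1).filter (fun _ => (⟨0, 0⟩ : Σ _ : ℕ, ℕ) = σ),
          ∫ _v : Unit, (cond b Pol.small Pol.large).shell (max ((1 - (1 / 2 : ℝ)) * 1) (min 1 (3 / 4 : ℝ))) 1 (1 / 2)
              (((1 / 2 : ℝ) ^ (K - 0) / 4 + T4LipschitzLedger.Sanity.ρ (K - 0)) * 1) *
            (∏ j : Fin 1, (if (j : ℕ) = i then (1 : ℝ) else (cond b Pol.small Pol.large).fac (smallInd (3 / 4 : ℝ) (Sv j)))) * (1 : ℝ)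
            ∂(Measure.dirac ()) ≤
        2 * ∑ b : Bool, ∫ _v : Unit, (∏ i : Fin 1, (cond b Pol.small Pol.large).fac (smallInd (3 / 4 : ℝ) (Sv i))) * (1 : ℝ)
          ∂(Measure.dirac ())
      have hR : ∑ b : Bool, ∫ _v : Unit, (∏ i : Fin 1, (cond b Pol.small Pol.large).fac (smallInd (3 / 4 : ℝ) (Sv i))) * (1 : ℝ)
          ∂(Measure.dirac ()) = 1 := by
        simp only [integral_dirac, mul_one, Fin.prod_univ_one]
        exact toy_sum_sharp _ _
      rw [hR, Fintype.sum_bool, show (2 : ℝ) * 1 = 2 by norm_num]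
      linarith [toy_removal_le_one (cond true Pol.small Pol.large) (max ((1 - (1 / 2 : ℝ)) * 1) (min 1 (3 / 4 : ℝ))) (3 / 4)
          (((1 / 2 : ℝ) ^ (K - 0) / 4 + T4LipschitzLedger.Sanity.ρ (K - 0)) * 1) σ Sv,
        toy_removal_le_one (cond false Pol.small Pol.large) (max ((1 - (1 / 2 : ℝ)) * 1) (min 1 (3 / 4 : ℝ))) (3 / 4)
          (((1 / 2 : ℝ) ^ (K - 0) / 4 + T4LipschitzLedger.Sanity.ρ (K - 0)) * 1) σ Sv]
    · -- run B: the same AT RUN B's OWN THRESHOLDS `θ^B_K · S`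
      intro σ _ K t _ Sv _
      show ∑ b : Bool, ∑ i ∈ (Finset.range 1).filter (fun _ => (⟨0, 0⟩ : Σ _ : ℕ, ℕ) = σ),
          ∫ _v : Unit, (cond b Pol.small Pol.large).shell (max ((1 - (1 / 2 : ℝ)) * 1) (min 1 (1 / (1 + (1 / 2 : ℝ) ^ K / 8) *
              ((1 + (1 / 2 : ℝ) ^ K / 8) * (3 / 4 + (1 / 2 : ℝ) ^ K / 8))))) 1 (1 / 2)
              (((1 / 2 : ℝ) ^ (K - 0) / 4 + T4LipschitzLedger.Sanity.ρ (K - 0)) * 1) *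
            (∏ j : Fin 1, (if (j : ℕ) = i then (1 : ℝ) else (cond b Pol.small Pol.large).fac
              (smallInd ((1 + (1 / 2 : ℝ) ^ K / 8) * (3 / 4 + (1 / 2 : ℝ) ^ K / 8)) ((1 + (1 / 2 : ℝ) ^ K / 8) / 1 * Sv j)))) * (1 : ℝ)
            ∂(Measure.dirac ()) ≤
        2 * ∑ b : Bool, ∫ _v : Unit, (∏ i : Fin 1, (cond b Pol.small Pol.large).fac
          (smallInd ((1 + (1 / 2 : ℝ) ^ K / 8) * (3 / 4 + (1 / 2 : ℝ) ^ K / 8)) ((1 + (1 / 2 : ℝ) ^ K / 8) / 1 * Sv i))) * (1 : ℝ)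
          ∂(Measure.dirac ())
      have hR : ∑ b : Bool, ∫ _v : Unit, (∏ i : Fin 1, (cond b Pol.small Pol.large).fac
          (smallInd ((1 + (1 / 2 : ℝ) ^ K / 8) * (3 / 4 + (1 / 2 : ℝ) ^ K / 8)) ((1 + (1 / 2 : ℝ) ^ K / 8) / 1 * Sv i))) * (1 : ℝ)
          ∂(Measure.dirac ()) = 1 := by
        simp only [integral_dirac, mul_one, Fin.prod_univ_one]
        exact toy_sum_sharp _ _
      rw [hR, Fintype.sum_bool, show (2 : ℝ) * 1 = 2 by norm_num]
      linarith [toy_removal_le_one (cond true Pol.small Pol.large) (max ((1 - (1 / 2 : ℝ)) * 1) (min 1 (1 / (1 + (1 / 2 : ℝ) ^ K / 8) *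
            ((1 + (1 / 2 : ℝ) ^ K / 8) * (3 / 4 + (1 / 2 : ℝ) ^ K / 8))))) ((1 + (1 / 2 : ℝ) ^ K / 8) * (3 / 4 + (1 / 2 : ℝ) ^ K / 8))
          (((1 / 2 : ℝ) ^ (K - 0) / 4 + T4LipschitzLedger.Sanity.ρ (K - 0)) * 1) σ (fun j => (1 + (1 / 2 : ℝ) ^ K / 8) / 1 * Sv j),
        toy_removal_le_one (cond false Pol.small Pol.large) (max ((1 - (1 / 2 : ℝ)) * 1) (min 1 (1 / (1 + (1 / 2 : ℝ) ^ K / 8) *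
            ((1 + (1 / 2 : ℝ) ^ K / 8) * (3 / 4 + (1 / 2 : ℝ) ^ K / 8))))) ((1 + (1 / 2 : ℝ) ^ K / 8) * (3 / 4 + (1 / 2 : ℝ) ^ K / 8))
          (((1 / 2 : ℝ) ^ (K - 0) / 4 + T4LipschitzLedger.Sanity.ρ (K - 0)) * 1) σ (fun j => (1 + (1 / 2 : ℝ) ^ K / 8) / 1 * Sv j)]
  · intro K
    exact ⟨true, Finset.mem_univ _⟩
  · intro K t b
    refine ⟨by norm_num, ?_⟩
    have hx0 := half_pow_pos K
    have hx1 := half_pow_le_one K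
    cases b <;> simp only [Bool.cond_true, Bool.cond_false] <;> linarith
  · intro K t
    exact ⟨⟨true, lt_of_lt_of_eq (by positivity : (0 : ℝ) < (1 / 2 : ℝ) ^ K / 4) (toy_shell_true_A₂ K t).symm⟩,
      ⟨false, lt_of_lt_of_eq (by positivity : (0 : ℝ) < (1 / 2 : ℝ) ^ K / 4) (toy_shell_false_B₂ K t).symm⟩⟩
  · intro K
    positivity

end Summit.QuantumFields.YangMills.Theorems.N21AtSpineCarriersMixtureTwoThresholdsCommonBoxSanity

end
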